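import Literature.NumberTheory.EllipticCurves.ManinConstantLegendreTwistProofs
import HarnessLib

/-!
# `‖q‖₃ ≤ 1` at a potentially good additive prime `3` — stub `stub_potGoodThree` of line
# `Sketch`, crux `MazurKenkuBound` (stmt-ABC-15125)

WHAT. For the data of Edixhoven's fact `edixhoven_int_of_neronLattice_eq_smul_periodLattice`
(`W'/ℚ` globally minimal with newform `f`, Néron period pair `L'` with `Λ_{L'} = q·Λ_f`
exactly) at an ADDITIVE prime `3` (`3 ∣ Δ_min`, `3 ∣ c₄`) of POTENTIALLY GOOD reduction
(`‖j‖₃ ≤ 1`): `‖q‖₃ ≤ 1`. The registered stub carries two algebraic inputs as hypotheses — the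
finite-height statement in characteristic `3` for `y² = x³ + a₂x² + a₄x` (a nonzero coefficient
of `[3]` in degree `0 < J ≤ 9`) and the `3`-adic inequalities `‖A‖⁶ ≤ ‖Δ‖`, `‖B‖³ = ‖Δ‖` for
`y² = x³ + Ax² + Bx` — which the proof below does not need.

PROOF. This is now a theorem of the tree:
`Literature.NumberTheory.EllipticCurves.padicNorm_le_one_of_neronLattice_eq_smul_periodLattice_of_norm_j_le_one_three`
(`ManinConstantLegendreTwistProofs`): over `K = ℚ₃(e₁, e₂, e₃, Δ^{1/12})` the Legendre twist of
`W'` by `u = Δ^{1/12} = wϖᵏ` (`exists_legendreTwist_of_norm_j_le_one`, `12k = e·v₃(Δ_min)`) is an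
`𝒪_K`-curve `V''` with `V'' ⊗ K = (ϖᵏ, r, s, t) • (W' ⊗ K)` and unit discriminant, hence of
finite height `≤ 2` over the residue field (a unit coefficient of `[3]_{V''}` in degree `3` or
`9`, `FormalMulThreeHeightDichotomyProofs`); the Kraus bound `v₃(Δ_min) ≤ 13`
(`not_pow_dvd_c₄_minimalDiscriminantInt_three` with `‖c₄‖³ ≤ ‖Δ‖`) gives `8k < 9e`, and the
Newton-polygon ender `…_of_goodTwist_three` / `…_of_semistableTwist_sharp` concludes. We simply
specialise that theorem, discarding the two unused hypotheses.

## References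
* [EdixhovenManin1991] B. Edixhoven, *On the Manin constants of modular elliptic curves*,
  in: Arithmetic algebraic geometry (Texel, 1989), Progr. Math. 89 (1991), 25–39, Prop. 2.
* [SilvermanAEC2009] J. H. Silverman, *The Arithmetic of Elliptic Curves*, 2nd ed., GTM 106,
  Springer 2009: VII.5.4, VII.5.5 (potentially good reduction), Ex. 7.1 (Kraus).
-/

-- `Summit.<Summit>.<Problem>` is the mandated summit-side namespace (CONVENTIONS §2); for the
-- single-conjunct summit `ABC` the two coincide, so the duplicate `ABC.ABC` is deliberate.
set_option linter.dupNamespace false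

noncomputable section

open scoped MatrixGroups ModularForm NNReal NumberField Classical

open CongruenceSubgroup
open WeierstrassCurve
open IsDedekindDomain Field
open PowerSeries
open Literature.NumberTheory.EllipticCurves
open Literature.NumberTheory.EllipticCurves.ModularForms
open Literature.NumberTheory.GaloisRepresentations
open Literature.NumberTheory.Automorphic

namespace Summit.ABC.ABC.Theorems

/-- **`‖q‖₃ ≤ 1` for the data of Edixhoven's fact at an additive `3` with `‖j‖₃ ≤ 1`**, granted
(as hypotheses, at `Type 0`, and in fact not used) the finite-height input in characteristic `3`
(`a₁ = a₃ = a₆ = 0`, `Δ ≠ 0` ⇒ a nonzero coefficient of `[3]` in degree `0 < J ≤ 9`) and the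
`3`-adic inequalities for `y² = x³ + Ax² + Bx` (`‖A‖⁶ ≤ ‖Δ‖`, `‖B‖³ = ‖Δ‖` when
`‖c₄‖³ ≤ ‖Δ‖`). The conclusion is the tree's
`padicNorm_le_one_of_neronLattice_eq_smul_periodLattice_of_norm_j_le_one_three`: the Legendre
twist by `Δ^{1/12}` over `K = ℚ₃(e₁, e₂, e₃, Δ^{1/12})` is an `𝒪_K`-model with unit
discriminant, of finite height with a unit coefficient of `[3]` in degree `J ∈ {3, 9}`, and
`(J − 1)k < Je` because `12k = v₃(Δ_min)·e` with `v₃(Δ_min) ≤ 13` (Kraus); the sharp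
Newton-polygon ender `…_of_semistableTwist_sharp` then gives `‖q‖₃ ≤ 1`.
[cite: EdixhovenManin1991, Prop. 2] [cite: SilvermanAEC2009, VII.5.5 and Ex. 7.1] -/
theorem stub_potGoodThree :
    (∀ {k : Type} [Field k] [CharP k 3] (E : WeierstrassCurve k),
      E.a₁ = 0 → E.a₃ = 0 → E.a₆ = 0 → E.Δ ≠ 0 →
      ∃ J : ℕ, 0 < J ∧ J ≤ 9 ∧ coeff J (E.formalMul 3) ≠ 0) →
    (∀ {F : Type} [NormedField F] [IsUltrametricDist F], ‖(3 : F)‖ = 3⁻¹ → ‖(2 : F)‖ = 1 →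
      ∀ (A B : F), ‖A‖ ≤ 1 → ‖B‖ ≤ 1 → 16 * B ^ 2 * (A ^ 2 - 4 * B) ≠ 0 →
      ‖16 * (A ^ 2 - 3 * B)‖ ^ 3 ≤ ‖16 * B ^ 2 * (A ^ 2 - 4 * B)‖ →
      ‖A‖ ^ 6 ≤ ‖16 * B ^ 2 * (A ^ 2 - 4 * B)‖ ∧ ‖B‖ ^ 3 = ‖16 * B ^ 2 * (A ^ 2 - 4 * B)‖) →
    ∀ {N : ℕ} [NeZero N] {W' : WeierstrassCurve ℚ} [W'.IsElliptic] [W'.IsGloballyMinimal]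
      {f : CuspForm (Gamma0 N) 2} {L' : PeriodPair}, IsNewformOf W' f →
      IsNeronLatticeOf (W'.baseChange ℂ) L' → ∀ {q : ℚ},
      (∀ z ∈ periodLattice f, (q : ℂ) * z ∈ L'.lattice) →
      (∀ z ∈ L'.lattice, ∃ w ∈ periodLattice f, z = q * w) →
      (3 : ℤ) ∣ minimalDiscriminantInt W' → (3 : ℤ) ∣ (integralModelInt W').c₄ →
      ‖((W'.j : ℚ) : ℚ_[3])‖ ≤ 1 → ‖(q : ℚ_[3])‖ ≤ 1 := by
  intro _ _ N _ W' _ _ f L' hf hL' q hq hq' hΔ hc₄ hj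
  exact padicNorm_le_one_of_neronLattice_eq_smul_periodLattice_of_norm_j_le_one_three hf hL' hq
    hq' hΔ hc₄ hj

end Summit.ABC.ABC.Theorems

end
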